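import Summits.BirchSwinnertonDyer.BirchSwinnertonDyer.Theorems.CycTangentCMCycTangentBoundPeriodRigidity
import Literature.NumberTheory.EllipticCurves.IntSeriesIdentityPrinciple
import Literature.NumberTheory.EllipticCurves.IntSeriesValueNormRigidity
import Literature.NumberTheory.EllipticCurves.PAdicLFunctionInterpolationProofs
import Literature.NumberTheory.EllipticCurves.DeShalit1987.KatzPAdicLFunction
import HarnessLib

set_option linter.dupNamespace false
set_option autoImplicit false

/-!
# TWO-VARIABLE KATZ PERIOD NORM RIGIDITY — file 1 (the one-variable core and the period algebra)

Cell `bsd-print-cf2`, width seat `bsd-line-cf2c-w3` g4 (prover-bsd-line-cf2c-w3-g4-0), route C `PrintCf2RubinValueTwo`,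
`--supports stmt-BirchSwinnertonDyer-23722` (`RestrictedMainConjWithValueAtTwo`, the aside carrying the «(R) period-rigidity
exposure» of road α: the items 23721 / 23722 / the research kernel R of 23721 and the DECIDING child 24086
`MainConjClauseAtSplitTwoQuad` all quantify `∀ (Ω, δ, Ω_p) ∀ G₂, IsKatzMeasure₂ … Ω δ Ω_p G₂ → …`, so one must know how far
the period triple of a REALISED Katz measure can move).  Theses-free; THEOREMS ONLY (no `def`, no named fact, no `sorry`);
nothing is closed; BSD is not proved by any of this; no summit statement is proved by this seat.

File 2 (`…KatzPeriodNormRigidity`) proves: two solutions of de Shalit's two-variable frame `IsKatzMeasure₂` for the SAME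
branch `(ι, v, v̄, S, κ₁, κ₂, γ₁, γ₂, λ)` at two period triples `(Ω, δ, Ω_p)`, `(Ω', δ', Ω_p')` (the first solution non-zero)
have period ratios `A = ι⁻¹(Ω/Ω')·(Ω_p'/Ω_p)` and `B = ι⁻¹(δ/δ')` of NORM ONE, at every prime `p`.  This file holds the
period-free pieces:

* §1 `padicValue_eq_periodRatio_pow_mul` — de Shalit's prescribed value (II.4.16 (50) times `Ω_p^{m+j}`) at the second
  triple is `A^{m+j} · B^{j}` times the value at the first (pure algebra of (50));
  `norm_padicValue_eq_of_norm_periodRatio` — hence equal norms once `‖A‖ = ‖B‖ = 1`.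
* §2 the ONE-VARIABLE CORE of the `ctcm` cell (`CycTangentCMCycTangentBoundPeriodRigidity.norm_sub_one_lt_one_of_values_mul_pow`,
  -p4 p592643: values `y_t = c·D^t·x_t` at the nodes `u^t − 1` of a principal unit force `D` to be a principal unit, by `p`-adic
  continuity along `t₀ + pⁿ → t₀`) re-indexed to the nodes `t ≥ 1` / `t + 1` (`…_pos`, `…_succ`): the trivial character of a
  line is never in the interpolation range, so the node `t = 0` must not be used.
* §3 `eq_zero_of_hasValueAt_nodes_zero` — a series of `𝒪_{ℂ_p}⟦T⟧` vanishing at all nodes `u^{t+1} − 1` of a non-trivial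
  one-unit `u` of level `< ‖p‖` is zero (identity principle `IntSeries.eq_zero_of_infinite_zeros` on the closed disc of
  radius `‖u − 1‖`; the nodes are pairwise distinct by `IntSeries.forall_pow_ne_one_of_norm_sub_one_lt`);
  `norm_eq_one_of_two_principal_monomials` — `A^{e₁}B^{f}` and `A^{e₂}B^{f}` principal units with `e₁ ≠ e₂`, `f ≠ 0`
  force `‖A‖ = ‖B‖ = 1` (real exponent bookkeeping).

References: [deShalit1987] II.4.12 Remarks (iii)–(iv) (p. 66–67), II.4.16 (49)–(50) (p. 76–77), II.4.17 (52)–(54) (p. 77–78);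
[Washington1997] §5.1–§5.2; [Gouvea1993PadicNumbers] §5.6–§5.7.
-/

noncomputable section

open scoped NumberField Classical Topology
open Filter NumberField IsDedekindDomain Field
open Literature Literature.NumberTheory.GaloisRepresentations Literature.NumberTheory.EllipticCurves
open Summit.BirchSwinnertonDyer.Rank1Residual.X11b
open Summit.BirchSwinnertonDyer.BirchSwinnertonDyer.Theorems.CycTangentCMCycTangentBoundPeriodRigidity

namespace Summit.BirchSwinnertonDyer.BirchSwinnertonDyer.Theorems.PrintCf2.KatzPeriodRigidity

variable {p : ℕ} [Fact p.Prime] {K : Type} [Field K] [NumberField K]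

/-! ### §1 The prescribed values at two period triples differ by `A^{m+j} · B^{j}` -/

/-- **Two period triples, one algebraic part.** de Shalit's `p`-adic interpolation value
`ι⁻¹(interpolationValue … m j Ω δ L) · Ω_p^{m+j}` (II.4.16 (50): `Ω^{−(m+j)} (2π/δ)^j ×` period-free factors)
read at a second triple `(Ω', δ', Ω_p')` is the value at `(Ω, δ, Ω_p)` times `A^{m+j} · B^{j}` with the
PERIOD RATIOS `A = ι⁻¹(Ω/Ω') · (Ω_p'/Ω_p)` and `B = ι⁻¹(δ/δ')` (`Ω, δ, Ω_p ≠ 0`).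
[cite: deShalit1987, II.4.16 (50) (p. 77) with II.4.14 (36) (p. 71)] -/
theorem padicValue_eq_periodRatio_pow_mul (ι : PadicAlgCl p ≃+* ℂ) (v vbar : HeightOneSpectrum (𝓞 K))
    (S : Finset (HeightOneSpectrum (𝓞 K))) (ε : HeckeCharacter K) (m j : ℕ) {Ω δ : ℂ} (Ω' δ' Lval : ℂ)
    {Ωp : ℂ_[p]} (Ωp' : ℂ_[p]) (hΩ : Ω ≠ 0) (hδ : δ ≠ 0) (hΩp : Ωp ≠ 0) :
    (((ι.symm (DeShalit1987.interpolationValue p v vbar S ε m j Ω' δ' Lval)) : PadicAlgCl p) : ℂ_[p]) *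
        Ωp' ^ (m + j) =
      ((((ι.symm (Ω / Ω')) : PadicAlgCl p) : ℂ_[p]) * (Ωp' / Ωp)) ^ (m + j) *
        ((((ι.symm (δ / δ')) : PadicAlgCl p) : ℂ_[p])) ^ j *
        ((((ι.symm (DeShalit1987.interpolationValue p v vbar S ε m j Ω δ Lval)) : PadicAlgCl p) : ℂ_[p]) *
          Ωp ^ (m + j)) := by
  -- abbreviate the coefficient map `ℂ → ℂ_p`
  set φ : ℂ →+* ℂ_[p] := (algebraMap (PadicAlgCl p) ℂ_[p]).comp ι.symm.toRingHom with hφdef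
  have hφ : ∀ z : ℂ, (((ι.symm z) : PadicAlgCl p) : ℂ_[p]) = φ z := fun z ↦ by
    rw [hφdef, RingHom.coe_comp, Function.comp_apply, PadicComplex.coe_eq]; rfl
  simp only [hφ]
  have hΩφ : φ Ω ≠ 0 := (map_ne_zero φ).mpr hΩ
  have hδφ : φ δ ≠ 0 := (map_ne_zero φ).mpr hδ
  -- the pure field identity behind the statement
  have key : ∀ (a a' d d' tp r₁ r₂ r₃ L P P' : ℂ_[p]), a ≠ 0 → d ≠ 0 → P ≠ 0 →
      (a' ^ (m + j))⁻¹ * (tp / d') ^ j * r₁ * r₂ * r₃ * L * P' ^ (m + j) =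
        (a / a' * (P' / P)) ^ (m + j) * (d / d') ^ j *
          ((a ^ (m + j))⁻¹ * (tp / d) ^ j * r₁ * r₂ * r₃ * L * P ^ (m + j)) := by
    intro a a' d d' tp r₁ r₂ r₃ L P P' ha hd hP
    simp only [div_pow, mul_pow]
    have h1 : a ^ (m + j) / a' ^ (m + j) * (P' ^ (m + j) / P ^ (m + j)) * (d ^ j / d' ^ j) *
        ((a ^ (m + j))⁻¹ * (tp ^ j / d ^ j) * r₁ * r₂ * r₃ * L * P ^ (m + j)) =
        (a ^ (m + j) * (a ^ (m + j))⁻¹) * (P ^ (m + j) / P ^ (m + j)) * (d ^ j / d ^ j) *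
          ((a' ^ (m + j))⁻¹ * (tp ^ j / d' ^ j) * r₁ * r₂ * r₃ * L * P' ^ (m + j)) := by ring
    rw [h1, mul_inv_cancel₀ (pow_ne_zero _ ha), div_self (pow_ne_zero _ hP), div_self (pow_ne_zero _ hd)]
    ring
  unfold DeShalit1987.interpolationValue
  simp only [map_mul, map_inv₀, map_pow, map_div₀]
  exact key _ _ _ _ _ _ _ _ _ _ _ hΩφ hδφ hΩp


/-- **Equal norms of all prescribed values (algebra).** If the period ratios `A = ι⁻¹(Ω/Ω')·(Ω_p'/Ω_p)` and
`B = ι⁻¹(δ/δ')` have norm one, de Shalit's `p`-adic interpolation values at the two triples have EQUAL NORM at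
every `(ε, m, j, L)`. [cite: deShalit1987, II.4.16 (50) (p. 77)] -/
theorem norm_padicValue_eq_of_norm_periodRatio (ι : PadicAlgCl p ≃+* ℂ) (v vbar : HeightOneSpectrum (𝓞 K))
    (S : Finset (HeightOneSpectrum (𝓞 K))) (ε : HeckeCharacter K) (m j : ℕ) {Ω δ Ω' δ' : ℂ} (Lval : ℂ)
    {Ωp Ωp' : ℂ_[p]} (hΩ : Ω ≠ 0) (hδ : δ ≠ 0) (hΩp : Ωp ≠ 0)
    (hA : ‖(((ι.symm (Ω / Ω')) : PadicAlgCl p) : ℂ_[p]) * (Ωp' / Ωp)‖ = 1)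
    (hB : ‖(((ι.symm (δ / δ')) : PadicAlgCl p) : ℂ_[p])‖ = 1) :
    ‖(((ι.symm (DeShalit1987.interpolationValue p v vbar S ε m j Ω' δ' Lval)) : PadicAlgCl p) : ℂ_[p]) *
        Ωp' ^ (m + j)‖ =
      ‖(((ι.symm (DeShalit1987.interpolationValue p v vbar S ε m j Ω δ Lval)) : PadicAlgCl p) : ℂ_[p]) *
        Ωp ^ (m + j)‖ := by
  rw [padicValue_eq_periodRatio_pow_mul ι v vbar S ε m j Ω' δ' Lval Ωp' hΩ hδ hΩp, norm_mul, norm_mul,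
    norm_pow, norm_pow, hA, hB, one_pow, one_pow, one_mul, one_mul]

/-! ### §2 The one-variable core along nodes `u^t − 1`, `t ≥ 1` -/

/-- **Period rigidity, core, nodes `t ≥ 1`** (the tree's
`CycTangentCMCycTangentBoundPeriodRigidity.norm_sub_one_lt_one_of_values_mul_pow` with the node `t = 0`
removed — the trivial character of a line is never in de Shalit's interpolation range): if `F, F' ∈ 𝒪_{ℂ_p}⟦T⟧`
take values `x_t`, `y_t = c · D^t · x_t` at the nodes `u^t − 1` for `t ≥ 1` (`‖u − 1‖ < 1`, `c, D ≠ 0`) and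
`x_{t₀} ≠ 0` for some `t₀ ≥ 1`, then `D` is a principal unit, `‖D − 1‖ < 1`: along `t₀ + pⁿ → t₀` both value
sequences converge, forcing `D^{pⁿ} → 1`. [cite: Washington1997, §5.1–§5.2] [cite: deShalit1987, II.4.12 Remark (p. 66–67)] -/
theorem norm_sub_one_lt_one_of_values_mul_pow_pos (F F' : PowerSeries (PadicComplexInt p))
    {u c D : ℂ_[p]} (hu : ‖u - 1‖ < 1) (hc : c ≠ 0) (hD : D ≠ 0) {x y : ℕ → ℂ_[p]}
    (hx : ∀ t, 1 ≤ t → IntSeries.HasValueAt F (u ^ t - 1) (x t))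
    (hy : ∀ t, 1 ≤ t → IntSeries.HasValueAt F' (u ^ t - 1) (y t))
    (hxy : ∀ t, 1 ≤ t → y t = c * D ^ t * x t) {t₀ : ℕ} (ht₀ : 1 ≤ t₀) (h0 : x t₀ ≠ 0) :
    ‖D - 1‖ < 1 := by
  set s : ℕ → ℕ := fun n ↦ t₀ + p ^ n with hs
  have hs1 : ∀ n, 1 ≤ s n := fun n ↦ le_trans ht₀ (Nat.le_add_right _ _)
  have hnode := tendsto_node hu t₀
  have hxlim : Tendsto (fun n ↦ x (s n)) atTop (𝓝 (x t₀)) :=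
    tendsto_value (fun n ↦ norm_pow_sub_one_lt_one hu (s n)) (norm_pow_sub_one_lt_one hu t₀)
      (fun n ↦ hx (s n) (hs1 n)) (hx t₀ ht₀) hnode
  have hylim : Tendsto (fun n ↦ y (s n)) atTop (𝓝 (y t₀)) :=
    tendsto_value (fun n ↦ norm_pow_sub_one_lt_one hu (s n)) (norm_pow_sub_one_lt_one hu t₀)
      (fun n ↦ hy (s n) (hs1 n)) (hy t₀ ht₀) hnode
  have hcD : c * D ^ t₀ ≠ 0 := mul_ne_zero hc (pow_ne_zero _ hD)
  have hz : Tendsto (fun n ↦ D ^ p ^ n * x (s n)) atTop (𝓝 (x t₀)) := by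
    have h1 : Tendsto (fun n ↦ (c * D ^ t₀)⁻¹ * y (s n)) atTop (𝓝 ((c * D ^ t₀)⁻¹ * y t₀)) :=
      hylim.const_mul _
    have h2 : (c * D ^ t₀)⁻¹ * y t₀ = x t₀ := by
      rw [hxy t₀ ht₀, ← mul_assoc, inv_mul_cancel₀ hcD, one_mul]
    rw [h2] at h1
    refine h1.congr' (Eventually.of_forall fun n ↦ ?_)
    show (c * D ^ t₀)⁻¹ * y (s n) = D ^ p ^ n * x (s n)
    rw [hxy (s n) (hs1 n), hs]
    simp only [pow_add]
    field_simp
  have hev : ∀ᶠ n in atTop, x (s n) ≠ 0 := hxlim.eventually_ne h0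
  have hq : Tendsto (fun n ↦ D ^ p ^ n * x (s n) / x (s n)) atTop (𝓝 (x t₀ / x t₀)) :=
    hz.div hxlim h0
  rw [div_self h0] at hq
  have hDlim : Tendsto (fun n : ℕ ↦ D ^ p ^ n) atTop (𝓝 1) := by
    refine hq.congr' (hev.mono fun n hn ↦ ?_)
    exact mul_div_cancel_right₀ _ hn
  exact norm_sub_one_lt_one_of_tendsto hDlim


/-- **Period rigidity, core, nodes `u^{t+1} − 1`** (`t ∈ ℕ`): the `_pos` version re-indexed so that a
supply `t ↦ ρ_{t+1}` through all of `ℕ` can be fed without side conditions; the value relation is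
`y_t = c · D^t · x_t`. [cite: Washington1997, §5.1–§5.2] [cite: deShalit1987, II.4.12 Remark (p. 66–67)] -/
theorem norm_sub_one_lt_one_of_values_mul_pow_succ (F F' : PowerSeries (PadicComplexInt p))
    {u c D : ℂ_[p]} (hu : ‖u - 1‖ < 1) (hc : c ≠ 0) (hD : D ≠ 0) {x y : ℕ → ℂ_[p]}
    (hx : ∀ t, IntSeries.HasValueAt F (u ^ (t + 1) - 1) (x t))
    (hy : ∀ t, IntSeries.HasValueAt F' (u ^ (t + 1) - 1) (y t))
    (hxy : ∀ t, y t = c * D ^ t * x t) {t₀ : ℕ} (h0 : x t₀ ≠ 0) : ‖D - 1‖ < 1 := by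
  refine norm_sub_one_lt_one_of_values_mul_pow_pos F F' hu (mul_ne_zero hc (inv_ne_zero hD)) hD
    (x := fun t ↦ x (t - 1)) (y := fun t ↦ y (t - 1)) (fun t ht ↦ ?_) (fun t ht ↦ ?_) (fun t ht ↦ ?_)
    (t₀ := t₀ + 1) (Nat.le_add_left 1 t₀) (by simpa using h0)
  · simpa [Nat.sub_add_cancel ht] using hx (t - 1)
  · simpa [Nat.sub_add_cancel ht] using hy (t - 1)
  · show y (t - 1) = c * D⁻¹ * D ^ t * x (t - 1)
    rw [hxy (t - 1)]
    obtain ⟨t', rfl⟩ := Nat.exists_eq_add_of_le ht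
    simp only [Nat.add_sub_cancel_left, pow_add, pow_one]
    field_simp


/-! ### §3 Two bookkeeping lemmas for the two-variable theorem -/

omit [NumberField K] in
/-- **Zero nodes on a line kill the line.** If `F ∈ 𝒪_{ℂ_p}⟦T⟧` takes the value `0` at every node `u^{t+1} − 1`
(`t ∈ ℕ`) of a one-unit `u ≠ 1` of level `‖u − 1‖ < ‖p‖`, then `F = 0`: the nodes are pairwise distinct (`u` is not a
root of unity, `IntSeries.forall_pow_ne_one_of_norm_sub_one_lt`) and lie in the closed disc of radius `‖u − 1‖ < 1`, so
the identity principle `IntSeries.eq_zero_of_infinite_zeros` applies. [cite: Gouvea1993PadicNumbers, §5.6 Cor. 5.6.3–5.6.4] -/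
theorem eq_zero_of_hasValueAt_nodes_zero (F : PowerSeries (PadicComplexInt p)) {u : ℂ_[p]} (hu1 : u ≠ 1)
    (husmall : ‖u - 1‖ < ‖(p : ℂ_[p])‖) (h : ∀ t : ℕ, IntSeries.HasValueAt F (u ^ (t + 1) - 1) 0) : F = 0 := by
  have hu : ‖u - 1‖ < 1 := husmall.trans_le norm_prime_padicComplex_lt_one.le
  have hu0 : u ≠ 0 := fun h0 ↦ by
    rw [h0, zero_sub, norm_neg, norm_one] at hu
    exact lt_irrefl _ hu
  have hinj : Function.Injective fun t : ℕ ↦ u ^ (t + 1) - 1 := by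
    intro t t' htt'
    have h1 : u ^ (t + 1) = u ^ (t' + 1) := sub_left_injective htt'
    by_contra hne
    rcases Nat.lt_or_gt_of_ne hne with hlt | hlt
    · have h3 : u ^ (t' + 1) = u ^ (t + 1) * u ^ (t' - t) := by rw [← pow_add]; congr 1; omega
      rw [h3] at h1
      exact IntSeries.forall_pow_ne_one_of_norm_sub_one_lt hu1 husmall (t' - t) (by omega)
        ((mul_eq_left₀ (pow_ne_zero _ hu0)).mp h1.symm)
    · have h3 : u ^ (t + 1) = u ^ (t' + 1) * u ^ (t - t') := by rw [← pow_add]; congr 1; omega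
      rw [h3] at h1
      exact IntSeries.forall_pow_ne_one_of_norm_sub_one_lt hu1 husmall (t - t') (by omega)
        ((mul_eq_left₀ (pow_ne_zero _ hu0)).mp h1)
  refine IntSeries.eq_zero_of_infinite_zeros (ϖ := u - 1) (sub_ne_zero.mpr hu1) hu
    ((Set.infinite_range_of_injective hinj).mono ?_)
  rintro _ ⟨t, rfl⟩
  exact ⟨R1.norm_pow_sub_one_le hu (t + 1), h t⟩

/-- **Two principal monomials pin the norms.** If `A, B ≠ 0` in `ℂ_p` and both `A^{e₁}B^{f}` and `A^{e₂}B^{f}` are principal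
units with `e₁ ≠ e₂` and `f ≠ 0`, then `‖A‖ = 1` and `‖B‖ = 1`. [folklore] -/
theorem norm_eq_one_of_two_principal_monomials {A B : ℂ_[p]} (hA0 : A ≠ 0) (hB0 : B ≠ 0) {e₁ e₂ f : ℕ}
    (he : e₁ ≠ e₂) (hf : f ≠ 0) (h₁ : ‖A ^ e₁ * B ^ f - 1‖ < 1) (h₂ : ‖A ^ e₂ * B ^ f - 1‖ < 1) :
    ‖A‖ = 1 ∧ ‖B‖ = 1 := by
  have h1 : ‖A‖ ^ e₁ * ‖B‖ ^ f = 1 := by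
    rw [← norm_pow, ← norm_pow, ← norm_mul]; exact R1.norm_eq_one_of_norm_sub_one_lt h₁
  have h2 : ‖A‖ ^ e₂ * ‖B‖ ^ f = 1 := by
    rw [← norm_pow, ← norm_pow, ← norm_mul]; exact R1.norm_eq_one_of_norm_sub_one_lt h₂
  have hBpos : 0 < ‖B‖ := norm_pos_iff.mpr hB0
  have hApos : 0 < ‖A‖ := norm_pos_iff.mpr hA0
  have h3 : ‖A‖ ^ e₁ = ‖A‖ ^ e₂ := mul_right_cancel₀ (pow_pos hBpos _).ne' (h1.trans h2.symm)
  have hA1 : ‖A‖ = 1 := by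
    by_contra hA1
    exact he (pow_right_injective₀ hApos hA1 h3)
  refine ⟨hA1, ?_⟩
  rw [hA1, one_pow, one_mul] at h1
  exact (pow_eq_one_iff_of_nonneg hBpos.le hf).mp h1

end Summit.BirchSwinnertonDyer.BirchSwinnertonDyer.Theorems.PrintCf2.KatzPeriodRigidity

end
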